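import Summits.QuantumFields.YangMills.Theorems.LuscherReductionTwistedTraceScalingBTOffDiagonalRatio
import Mathlib.Analysis.Quaternion
import HarnessLib

/-!
# (L1) THE KINETIC COUPLING IS A SUM OF SQUARES: `TC(U, V^g) = 2|E| − Σ_e ‖q(U_e)q(g_y) − q(g_x)q(V_e)‖²_ℍ`, the per-edge lower bound, the torus path bound and
# the colour-pinning amplitude bound (lane A of S-BASE, crux `TwistedTraceScaling` stmt-QuantumFields-20203, C4-CORE, the (B-T) pen; design note
# `pub/ym-fleet/ym-luscher-20007-p1/COARSE-DESIGN.md` §25.9)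

The far-pair / rough-gauge-field TAILS of the (B-T) kernel comparison need no expansion: in the quaternion model `q = su2Quat` (unit norm, multiplicative norm)
`Re tr(AB⁻¹) = 2 − ‖q(A) − q(B)‖²`, so the kinetic coupling against a gauge copy is `2|E|` minus the **kinetic defect**
`kinDefect U V g = Σ_e ‖q(U_e)q(g_{x+k}) − q(g_x)q(V_e)‖²` (`timeCoupling_gaugeTransform_eq_sub_kinDefect`), and `K_β(U, V^g) ≤ e^{2β|E| − β·kinDefect}`
(`transferKernel_gaugeTransform_le`) with NO first-order junk.  Lower bounds for the defect:
* `norm_edgeDefect_ge` — per edge `‖Δ_e‖ ≥ ‖q(g_y) − q(g_x)‖ − 2‖q(U_e) − 1‖‖q(g_x) − 1‖ − ‖q(U_e) − q(V_e)‖` (exact commutator algebra, `noncomm_ring`), `sq_edgeDefect_le_kinDefect`;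
* `norm_su2Quat_sub_base_le` — torus path bound: all edge jumps `≤ R` ⇒ `‖q(g_x) − q(g_0)‖ ≤ 3LR`;
* `colourQuatSum_ne_zero_of_near`, `norm_colourQuatSum_sub_smul_one_le`, ★ `norm_su2Quat_base_sub_one_le` — COLOUR PINNING: if all `g_x` are within `ϑ < 1` of `g_0` and the polar colour
  mean lies in `fpBall ε`, then `‖q(g_0) − 1‖ ≤ 2ϑ + ε` and the colour sum `S = Σ_x q(g_x)` satisfies `‖S − ‖S‖·1‖ ≤ ε‖S‖` (so `‖[q(u), S]‖ ≤ 2‖q(u) − 1‖·εN`);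
  ★ `norm_su2Quat_sub_one_le_of_jumps` — amplitude `≤ 9LR + ε` from jumps `≤ R` and pinning.
HONEST FRAMING: quaternion bookkeeping for a stub of a child of the CONDITIONAL reduction route R2b1; the tails, the floor and the assembly are OPEN; C4-CORE OPEN; not infinite volume,
not a gap, not Clay.
-/

set_option autoImplicit false

noncomputable section

open MeasureTheory Filter Topology Real
open scoped BigOperators Matrix Quaternion
open Literature.MathematicalPhysics.QuantumFieldTheory
open Literature.MathematicalPhysics.QuantumLattice

namespace Summit.QuantumFields.YangMills.Theorems.FemtoTransferGap.TwoLattice.ConstTube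

open Summit.QuantumFields.YangMills.Theorems.FemtoTransferGap
open Summit.QuantumFields.YangMills.Theorems.FemtoTransferGap.TwoLattice
open Summit.QuantumFields.YangMills.Theorems.FemtoTransferGap.TwoLattice.Avg
open Summit.QuantumFields.YangMills.Theorems.FemtoTransferGap.TwoLattice.Cov (scalarPart_inv vecPart_inv)

variable (L : ℕ) [NeZero L]

/-- **The kinetic defect** `Σ_e ‖q(U_e)q(g_{x+k}) − q(g_x)q(V_e)‖²` of a pair of configurations against a gauge field (`q = su2Quat`). [cite: Luscher1983, §3] -/
def kinDefect (U V : GaugeConfig 3 L SU2) (g : Site 3 L → SU2) : ℝ :=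
  ∑ e : Edge 3 L, ‖su2Quat (U e) * su2Quat (g (e.1.shift e.2)) - su2Quat (g e.1) * su2Quat (V e)‖ ^ 2

variable {L}

/-! ## §1 One link: `Re tr(AB⁻¹) = 2 − ‖q(A) − q(B)‖²` -/

/-- `u₀(AB⁻¹) = 1 − ‖q(A) − q(B)‖²/2`. [cite: MontvayMunster1994, §3.2.3 (3.97)] -/
theorem scalarPart_mul_inv_eq_one_sub (A B : SU2) : scalarPart (A * B⁻¹) = 1 - ‖su2Quat A - su2Quat B‖ ^ 2 / 2 := by
  rw [scalarPart_mul_inv, sq, ← Quaternion.normSq_eq_norm_mul_self, Quaternion.normSq_def']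
  have hA := scalarPart_sq_add A
  have hB := scalarPart_sq_add B
  simp only [Fin.sum_univ_three, scalarPart, vecPart, dotProduct, Matrix.cons_val_zero, Matrix.cons_val_one, Matrix.cons_val,
    Quaternion.re_sub, Quaternion.imI_sub, Quaternion.imJ_sub, Quaternion.imK_sub] at hA hB ⊢
  linear_combination (hA + hB) / 2

/-- `Re tr(AB⁻¹) = 2 − ‖q(A) − q(B)‖²`. [cite: MontvayMunster1994, §3.2.3 (3.97)] -/
theorem re_trace_su2Rep_mul_inv_eq_norm (A B : SU2) : ((su2Rep (A * B⁻¹)).trace).re = 2 - ‖su2Quat A - su2Quat B‖ ^ 2 := by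
  rw [re_trace_su2Rep_mul_inv, ← scalarPart_mul_inv, scalarPart_mul_inv_eq_one_sub]; ring

omit [NeZero L] in
/-- The link of a gauge copy: `‖q(U) − q(g_x V g_y⁻¹)‖ = ‖q(U)q(g_y) − q(g_x)q(V)‖` (the quaternion norm is multiplicative, `‖q(g)‖ = 1`). [folklore] -/
theorem norm_su2Quat_sub_gauge_link (U V gx gy : SU2) :
    ‖su2Quat U - su2Quat (gx * V * gy⁻¹)‖ = ‖su2Quat U * su2Quat gy - su2Quat gx * su2Quat V‖ := by
  have hmul := @Literature.MathematicalPhysics.QuantumFieldTheory.Balaban1983to89.T4HaarSU2Translate.su2Quat_mul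
  have h1 : su2Quat gy * su2Quat gy⁻¹ = 1 := by rw [← hmul, mul_inv_cancel, su2Quat_one]
  have e : su2Quat U - su2Quat (gx * V * gy⁻¹) = (su2Quat U * su2Quat gy - su2Quat gx * su2Quat V) * su2Quat gy⁻¹ := by
    rw [hmul, hmul, sub_mul, mul_assoc (su2Quat U) (su2Quat gy), h1, mul_one]
  rw [e, norm_mul, norm_su2Quat, mul_one]

/-! ## §2 The kinetic coupling against a gauge copy is `2|E|` minus the defect -/

/-- ★ `TC(U, V^g) = 2|E| − kinDefect U V g`. [cite: Luscher1983, §3] -/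
theorem timeCoupling_gaugeTransform_eq_sub_kinDefect (U V : GaugeConfig 3 L SU2) (g : Site 3 L → SU2) :
    timeCoupling su2Rep U (gaugeTransform g V) = 2 * (Fintype.card (Edge 3 L) : ℝ) - kinDefect L U V g := by
  unfold timeCoupling kinDefect
  have h : ∀ e : Edge 3 L, ((su2Rep (U e * (gaugeTransform g V e)⁻¹)).trace).re =
      2 - ‖su2Quat (U e) * su2Quat (g (e.1.shift e.2)) - su2Quat (g e.1) * su2Quat (V e)‖ ^ 2 := fun e => by
    rw [re_trace_su2Rep_mul_inv_eq_norm, show gaugeTransform g V e = g e.1 * V e * (g (e.1.shift e.2))⁻¹ from rfl, norm_su2Quat_sub_gauge_link]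
  simp only [h, Finset.sum_sub_distrib, Finset.sum_const, Finset.card_univ, nsmul_eq_mul]
  ring

/-- The defect is nonnegative. [folklore] -/
theorem kinDefect_nonneg (U V : GaugeConfig 3 L SU2) (g : Site 3 L → SU2) : 0 ≤ kinDefect L U V g :=
  Finset.sum_nonneg fun _ _ => sq_nonneg _

/-- One edge's squared defect is at most the total defect. [folklore] -/
theorem sq_edgeDefect_le_kinDefect (U V : GaugeConfig 3 L SU2) (g : Site 3 L → SU2) (e : Edge 3 L) :
    ‖su2Quat (U e) * su2Quat (g (e.1.shift e.2)) - su2Quat (g e.1) * su2Quat (V e)‖ ^ 2 ≤ kinDefect L U V g := by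
  unfold kinDefect
  exact Finset.single_le_sum (f := fun e : Edge 3 L => ‖su2Quat (U e) * su2Quat (g (e.1.shift e.2)) - su2Quat (g e.1) * su2Quat (V e)‖ ^ 2)
    (fun _ _ => sq_nonneg _) (Finset.mem_univ e)

/-- The transfer kernel against a gauge copy, exactly. [cite: Luscher1983, §3] -/
theorem transferKernel_gaugeTransform_eq (β : ℝ) (U V : GaugeConfig 3 L SU2) (g : Site 3 L → SU2) :
    transferKernel su2Rep β U (gaugeTransform g V) =
      Real.exp (β * (2 * (Fintype.card (Edge 3 L) : ℝ) - kinDefect L U V g) - β / 2 * (wilsonAction su2Rep U + wilsonAction su2Rep V)) := by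
  unfold transferKernel
  rw [timeCoupling_gaugeTransform_eq_sub_kinDefect, wilsonAction_gaugeTransform]

/-- ★ **Sum-of-squares kernel bound**: `K_β(U, V^g) ≤ exp(2β|E| − β·kinDefect)`. [cite: Luscher1983, §3] -/
theorem transferKernel_gaugeTransform_le {β : ℝ} (hβ : 0 ≤ β) (U V : GaugeConfig 3 L SU2) (g : Site 3 L → SU2) :
    transferKernel su2Rep β U (gaugeTransform g V) ≤ Real.exp (β * (2 * (Fintype.card (Edge 3 L) : ℝ)) - β * kinDefect L U V g) := by
  rw [transferKernel_gaugeTransform_eq]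
  refine Real.exp_le_exp.mpr ?_
  have h := mul_nonneg hβ (add_nonneg (wilsonAction_su2_nonneg_lat U) (wilsonAction_su2_nonneg_lat V))
  nlinarith [h]

/-! ## §3 The per-edge lower bound (rough gauge fields) -/

omit [NeZero L] in
/-- ★ **Per-edge defect**: `‖q(U)q(g_y) − q(g_x)q(V)‖ ≥ ‖q(g_y) − q(g_x)‖ − 2‖q(U) − 1‖‖q(g_x) − 1‖ − ‖q(U) − q(V)‖`
(`q(U)(b − a) + [q(U) − 1, a − 1] + a(q(U) − q(V))`). [folklore] -/
theorem norm_edgeDefect_ge (U V gx gy : SU2) :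
    ‖su2Quat gy - su2Quat gx‖ - 2 * ‖su2Quat U - 1‖ * ‖su2Quat gx - 1‖ - ‖su2Quat U - su2Quat V‖ ≤
      ‖su2Quat U * su2Quat gy - su2Quat gx * su2Quat V‖ := by
  have e : su2Quat U * su2Quat gy - su2Quat gx * su2Quat V =
      su2Quat U * (su2Quat gy - su2Quat gx) + ((su2Quat U - 1) * (su2Quat gx - 1) - (su2Quat gx - 1) * (su2Quat U - 1)) +
        su2Quat gx * (su2Quat U - su2Quat V) := by noncomm_ring
  have hX : ‖su2Quat U * (su2Quat gy - su2Quat gx)‖ = ‖su2Quat gy - su2Quat gx‖ := by rw [norm_mul, norm_su2Quat, one_mul]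
  have hZ : ‖su2Quat gx * (su2Quat U - su2Quat V)‖ = ‖su2Quat U - su2Quat V‖ := by rw [norm_mul, norm_su2Quat, one_mul]
  have hY : ‖(su2Quat U - 1) * (su2Quat gx - 1) - (su2Quat gx - 1) * (su2Quat U - 1)‖ ≤ 2 * ‖su2Quat U - 1‖ * ‖su2Quat gx - 1‖ := by
    refine (norm_sub_le _ _).trans ?_
    rw [norm_mul, norm_mul]; ring_nf; rfl
  have h3 : ‖su2Quat U * (su2Quat gy - su2Quat gx)‖ ≤ ‖su2Quat U * su2Quat gy - su2Quat gx * su2Quat V‖ +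
      ‖(su2Quat U - 1) * (su2Quat gx - 1) - (su2Quat gx - 1) * (su2Quat U - 1)‖ + ‖su2Quat gx * (su2Quat U - su2Quat V)‖ := by
    have h : ‖(su2Quat U * su2Quat gy - su2Quat gx * su2Quat V) + -((su2Quat U - 1) * (su2Quat gx - 1) - (su2Quat gx - 1) * (su2Quat U - 1)) +
        -(su2Quat gx * (su2Quat U - su2Quat V))‖ ≤ ‖su2Quat U * su2Quat gy - su2Quat gx * su2Quat V‖ +
        ‖-((su2Quat U - 1) * (su2Quat gx - 1) - (su2Quat gx - 1) * (su2Quat U - 1))‖ + ‖-(su2Quat gx * (su2Quat U - su2Quat V))‖ := norm_add₃_le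
    rw [norm_neg, norm_neg] at h
    have e2 : su2Quat U * su2Quat gy - su2Quat gx * su2Quat V + -((su2Quat U - 1) * (su2Quat gx - 1) - (su2Quat gx - 1) * (su2Quat U - 1)) +
        -(su2Quat gx * (su2Quat U - su2Quat V)) = su2Quat U * (su2Quat gy - su2Quat gx) := by rw [e]; abel
    rw [e2] at h; exact h
  rw [hX, hZ] at h3
  linarith

/-! ## §4 The torus path bound -/

/-- ★ **Path bound**: if every edge jump is `≤ R` then `‖q(g_x) − q(g_0)‖ ≤ 3LR`. [folklore] -/
theorem norm_su2Quat_sub_base_le {g : Site 3 L → SU2} {R : ℝ} (hR : ∀ e : Edge 3 L, ‖su2Quat (g (e.1.shift e.2)) - su2Quat (g e.1)‖ ≤ R) (x : Site 3 L) :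
    ‖su2Quat (g x) - su2Quat (g 0)‖ ≤ 3 * L * R := by
  have hR0 : 0 ≤ R := (norm_nonneg _).trans (hR default)
  have step : ∀ (k : Fin 3) (n : ℕ) (y : Site 3 L), ‖su2Quat (g (y + n • Pi.single k 1)) - su2Quat (g y)‖ ≤ n * R := by
    intro k n
    induction n with
    | zero => intro y; simp
    | succ n ih =>
      intro y
      have e1 : y + (n + 1) • Pi.single k (1 : ZMod L) = (y + n • Pi.single k 1).shift k := by
        simp only [Site.shift, succ_nsmul, add_assoc]
      rw [e1]
      have h1 := hR ((y + n • Pi.single k 1), k)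
      have h2 := ih y
      have h3 := norm_sub_le_norm_sub_add_norm_sub (su2Quat (g ((y + n • Pi.single k 1).shift k))) (su2Quat (g (y + n • Pi.single k 1))) (su2Quat (g y))
      push_cast
      linarith
  have hval : ∀ i : Fin 3, ((x i).val : ℝ) ≤ L := fun i => by exact_mod_cast (ZMod.val_lt (x i)).le
  set x₁ : Site 3 L := 0 + (x 0).val • Pi.single 0 1 with hx₁
  set x₂ : Site 3 L := x₁ + (x 1).val • Pi.single 1 1 with hx₂
  have hx : x = x₂ + (x 2).val • Pi.single 2 1 := by
    rw [hx₂, hx₁]; funext j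
    simp only [Pi.add_apply, Pi.smul_apply, Pi.zero_apply, Pi.single_apply]
    fin_cases j <;> simp
  have h0 := step 0 (x 0).val 0
  have h1 := step 1 (x 1).val x₁
  have h2 := step 2 (x 2).val x₂
  rw [← hx₁] at h0; rw [← hx₂] at h1; rw [← hx] at h2
  calc ‖su2Quat (g x) - su2Quat (g 0)‖ ≤ ‖su2Quat (g x) - su2Quat (g x₂)‖ + ‖su2Quat (g x₂) - su2Quat (g x₁)‖ + ‖su2Quat (g x₁) - su2Quat (g 0)‖ := by
        refine (norm_sub_le_norm_sub_add_norm_sub _ (su2Quat (g x₂)) _).trans ?_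
        linarith [norm_sub_le_norm_sub_add_norm_sub (su2Quat (g x₂)) (su2Quat (g x₁)) (su2Quat (g 0))]
    _ ≤ (x 2).val * R + (x 1).val * R + (x 0).val * R := add_le_add (add_le_add h2 h1) h0
    _ ≤ L * R + L * R + L * R := by
        refine add_le_add (add_le_add ?_ ?_) ?_ <;> exact mul_le_mul_of_nonneg_right (hval _) hR0
    _ = 3 * L * R := by ring

/-! ## §5 Colour pinning: the polar colour mean near `1` pins the base value -/

/-- The colour sum is within `Nϑ` of `N·q(g_0)` when every `g_x` is within `ϑ` of `g_0`. [folklore] -/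
theorem norm_colourQuatSum_sub_smul_base_le {g : Site 3 L → SU2} {ϑ : ℝ} (hg : ∀ x, ‖su2Quat (g x) - su2Quat (g 0)‖ ≤ ϑ) :
    ‖colourQuatSum L g - (Fintype.card (Site 3 L) : ℝ) • su2Quat (g 0)‖ ≤ Fintype.card (Site 3 L) * ϑ := by
  unfold colourQuatSum
  have e : ∑ x : Site 3 L, su2Quat (g x) - (Fintype.card (Site 3 L) : ℝ) • su2Quat (g 0) = ∑ x : Site 3 L, (su2Quat (g x) - su2Quat (g 0)) := by
    rw [Finset.sum_sub_distrib, Finset.sum_const, Finset.card_univ, ← Nat.cast_smul_eq_nsmul ℝ]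
  rw [e]
  refine (norm_sum_le _ _).trans ?_
  refine (Finset.sum_le_sum fun x _ => hg x).trans ?_
  rw [Finset.sum_const, Finset.card_univ, nsmul_eq_mul]

/-- … hence `|‖S‖ − N| ≤ Nϑ` and `S ≠ 0` when `ϑ < 1`. [folklore] -/
theorem abs_norm_colourQuatSum_sub_le {g : Site 3 L → SU2} {ϑ : ℝ} (hg : ∀ x, ‖su2Quat (g x) - su2Quat (g 0)‖ ≤ ϑ) :
    |‖colourQuatSum L g‖ - Fintype.card (Site 3 L)| ≤ Fintype.card (Site 3 L) * ϑ := by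
  have h := norm_colourQuatSum_sub_smul_base_le (L := L) hg
  have hn : ‖(Fintype.card (Site 3 L) : ℝ) • su2Quat (g 0)‖ = Fintype.card (Site 3 L) := by
    rw [norm_smul, norm_su2Quat, mul_one, Real.norm_eq_abs, abs_of_nonneg (Nat.cast_nonneg _)]
  have h2 := abs_norm_sub_norm_le (colourQuatSum L g) ((Fintype.card (Site 3 L) : ℝ) • su2Quat (g 0))
  rw [hn] at h2
  exact h2.trans h

/-- The colour sum does not vanish when the field is within `ϑ < 1` of its base value. [folklore] -/
theorem colourQuatSum_ne_zero_of_near {g : Site 3 L → SU2} {ϑ : ℝ} (hϑ : ϑ < 1) (hg : ∀ x, ‖su2Quat (g x) - su2Quat (g 0)‖ ≤ ϑ) :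
    colourQuatSum L g ≠ 0 := by
  intro h0
  have h := abs_norm_colourQuatSum_sub_le (L := L) hg
  rw [h0, norm_zero, zero_sub, abs_neg, abs_of_nonneg (Nat.cast_nonneg _)] at h
  have hN : (0 : ℝ) < Fintype.card (Site 3 L) := by exact_mod_cast Fintype.card_pos
  nlinarith

/-- ★ **Pinning of the colour sum**: on the Faddeev–Popov slab (`colourMean g ∈ fpBall ε`, colour sum `S ≠ 0`) `‖S − ‖S‖·1‖ ≤ ε‖S‖`. [folklore] -/
theorem norm_colourQuatSum_sub_smul_one_le {g : Site 3 L → SU2} {ε : ℝ} (hS : colourQuatSum L g ≠ 0) (hW : colourMean L g ∈ fpBall ε) :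
    ‖colourQuatSum L g - ‖colourQuatSum L g‖ • (1 : ℍ)‖ ≤ ε * ‖colourQuatSum L g‖ := by
  have hm : colourMean L g = quatToSU2 (colourQuatSum L g) := by unfold colourMean; rw [if_neg hS]
  have hq : su2Quat (colourMean L g) = ‖colourQuatSum L g‖⁻¹ • colourQuatSum L g := by
    rw [hm]; exact Literature.MathematicalPhysics.QuantumFieldTheory.Balaban1983to89.T4HaarSU2Translate.su2Quat_quatToSU2 hS
  have hε : ‖‖colourQuatSum L g‖⁻¹ • colourQuatSum L g - 1‖ < ε := by
    have h := hW; simp only [fpBall, Set.mem_setOf_eq, hq] at h; exact h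
  have hn : 0 < ‖colourQuatSum L g‖ := norm_pos_iff.mpr hS
  have e : colourQuatSum L g - ‖colourQuatSum L g‖ • (1 : ℍ) = ‖colourQuatSum L g‖ • (‖colourQuatSum L g‖⁻¹ • colourQuatSum L g - 1) := by
    rw [smul_sub, smul_smul, mul_inv_cancel₀ hn.ne', one_smul]
  rw [e, norm_smul, Real.norm_eq_abs, abs_of_pos hn, mul_comm]
  exact mul_le_mul_of_nonneg_right hε.le hn.le

/-- ★ **Pinning of the base value**: all `g_x` within `ϑ < 1` of `g_0` and `colourMean g ∈ fpBall ε` ⇒ `‖q(g_0) − 1‖ ≤ 2ϑ + ε`. [folklore] -/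
theorem norm_su2Quat_base_sub_one_le {g : Site 3 L → SU2} {ϑ ε : ℝ} (hϑ : ϑ < 1) (hg : ∀ x, ‖su2Quat (g x) - su2Quat (g 0)‖ ≤ ϑ)
    (hW : colourMean L g ∈ fpBall ε) : ‖su2Quat (g 0) - 1‖ ≤ 2 * ϑ + ε := by
  have hS := colourQuatSum_ne_zero_of_near (L := L) hϑ hg
  have hN : (0 : ℝ) < Fintype.card (Site 3 L) := by exact_mod_cast Fintype.card_pos
  have hn : 0 < ‖colourQuatSum L g‖ := norm_pos_iff.mpr hS
  have hE := norm_colourQuatSum_sub_smul_base_le (L := L) hg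
  have hA := abs_norm_colourQuatSum_sub_le (L := L) hg
  have hP := norm_colourQuatSum_sub_smul_one_le (L := L) hS hW
  -- `‖q₀ − N⁻¹S‖ ≤ ϑ`
  have h1 : ‖su2Quat (g 0) - (Fintype.card (Site 3 L) : ℝ)⁻¹ • colourQuatSum L g‖ ≤ ϑ := by
    have e : su2Quat (g 0) - (Fintype.card (Site 3 L) : ℝ)⁻¹ • colourQuatSum L g =
        -((Fintype.card (Site 3 L) : ℝ)⁻¹ • (colourQuatSum L g - (Fintype.card (Site 3 L) : ℝ) • su2Quat (g 0))) := by
      rw [smul_sub, smul_smul, inv_mul_cancel₀ hN.ne', one_smul]; abel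
    rw [e, norm_neg, norm_smul, Real.norm_eq_abs, abs_of_pos (inv_pos.mpr hN)]
    calc (Fintype.card (Site 3 L) : ℝ)⁻¹ * ‖colourQuatSum L g - (Fintype.card (Site 3 L) : ℝ) • su2Quat (g 0)‖
        ≤ (Fintype.card (Site 3 L) : ℝ)⁻¹ * (Fintype.card (Site 3 L) * ϑ) := mul_le_mul_of_nonneg_left hE (inv_pos.mpr hN).le
      _ = ϑ := by field_simp
  -- `‖N⁻¹S − ‖S‖⁻¹S‖ ≤ ϑ`
  have h2 : ‖(Fintype.card (Site 3 L) : ℝ)⁻¹ • colourQuatSum L g - ‖colourQuatSum L g‖⁻¹ • colourQuatSum L g‖ ≤ ϑ := by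
    rw [← sub_smul, norm_smul, Real.norm_eq_abs]
    have e : |(Fintype.card (Site 3 L) : ℝ)⁻¹ - ‖colourQuatSum L g‖⁻¹| * ‖colourQuatSum L g‖ =
        |‖colourQuatSum L g‖ - Fintype.card (Site 3 L)| / Fintype.card (Site 3 L) := by
      rw [show (Fintype.card (Site 3 L) : ℝ)⁻¹ - ‖colourQuatSum L g‖⁻¹ = (‖colourQuatSum L g‖ - Fintype.card (Site 3 L)) / (Fintype.card (Site 3 L) * ‖colourQuatSum L g‖) by
        field_simp, abs_div, abs_of_pos (mul_pos hN hn)]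
      field_simp
    rw [e, div_le_iff₀ hN]
    linarith
  -- `‖‖S‖⁻¹S − 1‖ ≤ ε`
  have h3 : ‖‖colourQuatSum L g‖⁻¹ • colourQuatSum L g - 1‖ ≤ ε := by
    have e : ‖colourQuatSum L g‖⁻¹ • colourQuatSum L g - 1 = ‖colourQuatSum L g‖⁻¹ • (colourQuatSum L g - ‖colourQuatSum L g‖ • (1 : ℍ)) := by
      rw [smul_sub, smul_smul, inv_mul_cancel₀ hn.ne', one_smul]
    rw [e, norm_smul, Real.norm_eq_abs, abs_of_pos (inv_pos.mpr hn)]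
    calc ‖colourQuatSum L g‖⁻¹ * ‖colourQuatSum L g - ‖colourQuatSum L g‖ • (1 : ℍ)‖ ≤ ‖colourQuatSum L g‖⁻¹ * (ε * ‖colourQuatSum L g‖) :=
          mul_le_mul_of_nonneg_left hP (inv_pos.mpr hn).le
      _ = ε := by field_simp
  calc ‖su2Quat (g 0) - 1‖ ≤ ‖su2Quat (g 0) - (Fintype.card (Site 3 L) : ℝ)⁻¹ • colourQuatSum L g‖ +
        ‖(Fintype.card (Site 3 L) : ℝ)⁻¹ • colourQuatSum L g - ‖colourQuatSum L g‖⁻¹ • colourQuatSum L g‖ + ‖‖colourQuatSum L g‖⁻¹ • colourQuatSum L g - 1‖ := by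
        refine (norm_sub_le_norm_sub_add_norm_sub _ (‖colourQuatSum L g‖⁻¹ • colourQuatSum L g) _).trans ?_
        linarith [norm_sub_le_norm_sub_add_norm_sub (su2Quat (g 0)) ((Fintype.card (Site 3 L) : ℝ)⁻¹ • colourQuatSum L g) (‖colourQuatSum L g‖⁻¹ • colourQuatSum L g)]
    _ ≤ ϑ + ϑ + ε := add_le_add (add_le_add h1 h2) h3
    _ = 2 * ϑ + ε := by ring

/-- ★★ **Amplitude from jumps and pinning**: all edge jumps `≤ R` with `3LR < 1` and `colourMean g ∈ fpBall ε` ⇒ every `‖q(g_x) − 1‖ ≤ 9LR + ε`. [folklore] -/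
theorem norm_su2Quat_sub_one_le_of_jumps {g : Site 3 L → SU2} {R ε : ℝ} (hR : ∀ e : Edge 3 L, ‖su2Quat (g (e.1.shift e.2)) - su2Quat (g e.1)‖ ≤ R)
    (hR1 : 3 * L * R < 1) (hW : colourMean L g ∈ fpBall ε) (x : Site 3 L) : ‖su2Quat (g x) - 1‖ ≤ 9 * L * R + ε := by
  have hpath := norm_su2Quat_sub_base_le (L := L) hR
  have h0 := norm_su2Quat_base_sub_one_le (L := L) hR1 hpath hW
  calc ‖su2Quat (g x) - 1‖ ≤ ‖su2Quat (g x) - su2Quat (g 0)‖ + ‖su2Quat (g 0) - 1‖ := norm_sub_le_norm_sub_add_norm_sub _ _ _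
    _ ≤ 3 * L * R + (2 * (3 * L * R) + ε) := add_le_add (hpath x) h0
    _ = 9 * L * R + ε := by ring

end Summit.QuantumFields.YangMills.Theorems.FemtoTransferGap.TwoLattice.ConstTube

end
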